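import Literature.Analysis.FluidPDE.RieszPressureModConst
import Literature.Analysis.FluidPDE.PineauVicolLocalPressureMass
import HarnessLib

/-!
# Dissipation ledger (LINE g10-α, crux 26567), stub L1 — far-field pressure tools under linear local-energy growth

Helper file for the registered stub `stub_dissipationBudget` (L1 `DissipationBudget`) of LINE g10-α `dissipation_ledger`
(crux `NearExtremalTransiencePerFlow`, stmt-NavierStokesRegularity-26567).  Pure analysis about one velocity slice
`v : ℝ³ → ℝ³` with LINEAR LOCAL-ENERGY GROWTH about the origin, `∫_{B(0,R)} ‖v‖² ≤ A·R` for all `R > 0`: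

* `lintegral_weight_mul_norm_sq_le_of_growth`, `integrable_weight_mul_norm_sq_of_growth`, `integral_weight_mul_norm_sq_le_of_growth`
  — the dyadic far-field sum `∫ (1+|y|)⁻⁴ ‖v y‖² dy ≤ 3A` (shells `2ᵏ ≤ 1+|y| < 2ᵏ⁺¹` carry `≤ 16⁻ᵏ · A·2ᵏ⁺¹`);
* `abs_farPotentialMod_le_of_growth` — the far part of the Riesz pressure modulo constants (base point `0`,
  `Literature.Analysis.FluidPDE.farPotentialMod 1 2 0 v`) is BOUNDED on `B̄(0,2)` by `C₀·A`, `C₀` absolute: the renormalised kernel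
  `D²Γ∞(x−y) − D²Γ∞(−y)` is `O(|x| (1+|y|)⁻⁴)` (tree `exists_norm_fderiv2_newtonFar_sub_sub_le`), so only the growth budget enters —
  no sup norm of `v`, which is what makes the pressure flux of a Type-I ancient field integrable up to the final time;
* `nearPotential_congr_of_eqOn_ball` — locality of the near potential `Q₁[v](x)` (kernel `Γ₀` supported in `|z| ≤ 2`): it only sees
  `v` on `B(x, 2)`.

HONEST FRAMING: elementary potential estimates; nothing about Navier–Stokes regularity is proved; no summit is proved by a line.
[cite: GilbargTrudinger2001, (2.14); Seregin2014, §6.2 Lemma 6.5]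
-/

noncomputable section

open MeasureTheory Set Filter Metric Topology Function
open scoped ENNReal NNReal

namespace Summit.NavierStokesRegularity.NavierStokesRegularity.Theorems

set_option linter.dupNamespace false

namespace NearExtremalTransiencePerFlow.DissipationLedger

open Literature.Analysis.FluidPDE Literature.Analysis.FluidPDE.RieszPressureModConst
open Literature.Analysis.FluidPDE.PineauVicol2026 (pressureSource_congr_of_eventuallyEq)

-- nested operator types `(EuclideanSpace ℝ (Fin 3)) →L[ℝ] (EuclideanSpace ℝ (Fin 3)) →L[ℝ] ℝ`
set_option maxSynthPendingDepth 3

/-! ### The dyadic far-field sum -/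

/-- The far-field weight `(1+|y|)⁻⁴` is continuous. [folklore] -/
theorem continuous_ffWeight : Continuous fun y : (EuclideanSpace ℝ (Fin 3)) => ((1 + ‖y‖) ^ 4)⁻¹ := by
  refine Continuous.inv₀ (by fun_prop) fun y => ?_
  have : 0 < (1 + ‖y‖) ^ 4 := by positivity
  exact this.ne'

/-- **Dyadic domination of the weight**: pointwise, `(1+|y|)⁻⁴ · ‖v y‖²` is at most the `k`-th term
`16⁻ᵏ · 𝟙_{B(0, 2ᵏ⁺¹)}(y) · ‖v y‖²` of the dyadic series for the shell index `k` with `2ᵏ ≤ 1 + |y| < 2ᵏ⁺¹`, hence at most the whole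
series (in `ℝ≥0∞`). [folklore] -/
theorem ofReal_ffWeight_mul_le_tsum (v : (EuclideanSpace ℝ (Fin 3)) → (EuclideanSpace ℝ (Fin 3))) (y : (EuclideanSpace ℝ (Fin 3))) :
    ENNReal.ofReal (((1 + ‖y‖) ^ 4)⁻¹ * ‖v y‖ ^ 2) ≤
      ∑' k : ℕ, (ball (0 : (EuclideanSpace ℝ (Fin 3))) (2 ^ (k + 1))).indicator (fun y => ENNReal.ofReal ((16 : ℝ)⁻¹ ^ k * ‖v y‖ ^ 2)) y := by
  obtain ⟨k, hk1, hk2⟩ := exists_nat_pow_near (x := 1 + ‖y‖) (y := (2 : ℝ)) (by linarith [norm_nonneg y]) one_lt_two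
  refine le_trans ?_ (ENNReal.le_tsum k)
  have hy : y ∈ ball (0 : (EuclideanSpace ℝ (Fin 3))) (2 ^ (k + 1)) := by
    rw [mem_ball_zero_iff]; linarith [norm_nonneg y]
  rw [indicator_of_mem hy]
  refine ENNReal.ofReal_le_ofReal (mul_le_mul_of_nonneg_right ?_ (sq_nonneg _))
  -- `(1+|y|)⁻⁴ ≤ (2ᵏ)⁻⁴ = 16⁻ᵏ`
  have h2k : (0 : ℝ) < 2 ^ k := by positivity
  calc ((1 + ‖y‖) ^ 4)⁻¹ ≤ (((2 : ℝ) ^ k) ^ 4)⁻¹ := by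
        refine inv_anti₀ (by positivity) ?_
        exact pow_le_pow_left₀ h2k.le hk1 4
    _ = (16 : ℝ)⁻¹ ^ k := by
        rw [← pow_mul, mul_comm, pow_mul, ← inv_pow]; norm_num

/-- Linear growth of the local energy makes `A` nonnegative. [folklore] -/
theorem growth_const_nonneg {v : (EuclideanSpace ℝ (Fin 3)) → (EuclideanSpace ℝ (Fin 3))} {A : ℝ} (hA : ∀ R : ℝ, 0 < R → ∫ z in ball (0 : (EuclideanSpace ℝ (Fin 3))) R, ‖v z‖ ^ 2 ≤ A * R) :
    0 ≤ A := by
  have h := hA 1 one_pos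
  have h0 : 0 ≤ ∫ z in ball (0 : (EuclideanSpace ℝ (Fin 3))) 1, ‖v z‖ ^ 2 := integral_nonneg fun z => sq_nonneg _
  linarith

/-- A continuous field is square integrable on every ball. [folklore] -/
theorem integrableOn_norm_sq_ball {v : (EuclideanSpace ℝ (Fin 3)) → (EuclideanSpace ℝ (Fin 3))} (hv : Continuous v) (c : (EuclideanSpace ℝ (Fin 3))) (R : ℝ) :
    IntegrableOn (fun z => ‖v z‖ ^ 2) (ball c R) := by
  have hc : Continuous fun z => ‖v z‖ ^ 2 := by fun_prop
  exact (hc.continuousOn.integrableOn_compact (isCompact_closedBall c R)).mono_set ball_subset_closedBall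

/-- **The dyadic far-field sum, `ℝ≥0∞` form**: `∫⁻ (1+|y|)⁻⁴ ‖v y‖² dy ≤ 3A` under linear growth `∫_{B(0,R)}‖v‖² ≤ A R`
(shell `k` contributes `≤ 16⁻ᵏ · A · 2ᵏ⁺¹`, and `Σ 2·8⁻ᵏ = 16/7 ≤ 3`). [folklore] -/
theorem lintegral_weight_mul_norm_sq_le_of_growth {v : (EuclideanSpace ℝ (Fin 3)) → (EuclideanSpace ℝ (Fin 3))} (hv : Continuous v) {A : ℝ}
    (hA : ∀ R : ℝ, 0 < R → ∫ z in ball (0 : (EuclideanSpace ℝ (Fin 3))) R, ‖v z‖ ^ 2 ≤ A * R) :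
    ∫⁻ y, ENNReal.ofReal (((1 + ‖y‖) ^ 4)⁻¹ * ‖v y‖ ^ 2) ≤ ENNReal.ofReal (3 * A) := by
  have hA0 : 0 ≤ A := growth_const_nonneg hA
  have hmeas : ∀ k : ℕ, Measurable fun y : (EuclideanSpace ℝ (Fin 3)) =>
      (ball (0 : (EuclideanSpace ℝ (Fin 3))) (2 ^ (k + 1))).indicator (fun y => ENNReal.ofReal ((16 : ℝ)⁻¹ ^ k * ‖v y‖ ^ 2)) y := by
    intro k
    refine Measurable.indicator ?_ measurableSet_ball
    exact ENNReal.measurable_ofReal.comp (by fun_prop)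
  calc ∫⁻ y, ENNReal.ofReal (((1 + ‖y‖) ^ 4)⁻¹ * ‖v y‖ ^ 2)
      ≤ ∫⁻ y, ∑' k : ℕ, (ball (0 : (EuclideanSpace ℝ (Fin 3))) (2 ^ (k + 1))).indicator
          (fun y => ENNReal.ofReal ((16 : ℝ)⁻¹ ^ k * ‖v y‖ ^ 2)) y :=
        lintegral_mono fun y => ofReal_ffWeight_mul_le_tsum v y
    _ = ∑' k : ℕ, ∫⁻ y, (ball (0 : (EuclideanSpace ℝ (Fin 3))) (2 ^ (k + 1))).indicator
          (fun y => ENNReal.ofReal ((16 : ℝ)⁻¹ ^ k * ‖v y‖ ^ 2)) y :=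
        lintegral_tsum fun k => (hmeas k).aemeasurable
    _ = ∑' k : ℕ, ENNReal.ofReal ((16 : ℝ)⁻¹ ^ k) * ∫⁻ y in ball (0 : (EuclideanSpace ℝ (Fin 3))) (2 ^ (k + 1)), ENNReal.ofReal (‖v y‖ ^ 2) := by
        refine tsum_congr fun k => ?_
        rw [lintegral_indicator measurableSet_ball, ← lintegral_const_mul' _ _ ENNReal.ofReal_ne_top]
        refine setLIntegral_congr_fun measurableSet_ball fun y _ => ?_
        rw [← ENNReal.ofReal_mul (by positivity)]
    _ ≤ ∑' k : ℕ, ENNReal.ofReal ((16 : ℝ)⁻¹ ^ k) * ENNReal.ofReal (A * 2 ^ (k + 1)) := by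
        refine ENNReal.tsum_le_tsum fun k => ?_
        gcongr
        have h2 : (0 : ℝ) < 2 ^ (k + 1) := by positivity
        rw [← ofReal_integral_eq_lintegral_ofReal (integrableOn_norm_sq_ball hv 0 _)
          (ae_of_all _ fun z => sq_nonneg _)]
        exact ENNReal.ofReal_le_ofReal (hA _ h2)
    _ = ∑' k : ℕ, ENNReal.ofReal (2 * A * ((8 : ℝ)⁻¹) ^ k) := by
        refine tsum_congr fun k => ?_
        rw [← ENNReal.ofReal_mul (by positivity)]
        congr 1
        rw [pow_succ, show ((16 : ℝ)⁻¹) ^ k = ((8 : ℝ)⁻¹) ^ k * ((2 : ℝ)⁻¹) ^ k by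
          rw [← mul_pow]; norm_num]
        have h2 : ((2 : ℝ)⁻¹) ^ k * 2 ^ k = 1 := by rw [← mul_pow]; norm_num
        calc ((8 : ℝ)⁻¹) ^ k * ((2 : ℝ)⁻¹) ^ k * (A * (2 ^ k * 2))
            = ((8 : ℝ)⁻¹) ^ k * A * 2 * (((2 : ℝ)⁻¹) ^ k * 2 ^ k) := by ring
          _ = 2 * A * ((8 : ℝ)⁻¹) ^ k := by rw [h2]; ring
    _ = ENNReal.ofReal (∑' k : ℕ, 2 * A * ((8 : ℝ)⁻¹) ^ k) := by
        rw [ENNReal.ofReal_tsum_of_nonneg (fun k => by positivity)]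
        exact (summable_geometric_of_lt_one (by norm_num) (by norm_num)).mul_left (2 * A)
    _ = ENNReal.ofReal (2 * A * (1 - (8 : ℝ)⁻¹)⁻¹) := by
        rw [tsum_mul_left, tsum_geometric_of_lt_one (by norm_num) (by norm_num)]
    _ ≤ ENNReal.ofReal (3 * A) := ENNReal.ofReal_le_ofReal (by norm_num; nlinarith)

/-- **Integrability of the weighted energy density** `(1+|y|)⁻⁴ ‖v y‖²` under linear growth. [folklore] -/
theorem integrable_weight_mul_norm_sq_of_growth {v : (EuclideanSpace ℝ (Fin 3)) → (EuclideanSpace ℝ (Fin 3))} (hv : Continuous v) {A : ℝ}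
    (hA : ∀ R : ℝ, 0 < R → ∫ z in ball (0 : (EuclideanSpace ℝ (Fin 3))) R, ‖v z‖ ^ 2 ≤ A * R) :
    Integrable fun y => ((1 + ‖y‖) ^ 4)⁻¹ * ‖v y‖ ^ 2 := by
  have hc : Continuous fun y => ((1 + ‖y‖) ^ 4)⁻¹ * ‖v y‖ ^ 2 := continuous_ffWeight.mul (by fun_prop)
  refine ⟨hc.aestronglyMeasurable, ?_⟩
  rw [hasFiniteIntegral_iff_ofReal (ae_of_all _ fun y => mul_nonneg (by positivity) (sq_nonneg _))]
  exact (lintegral_weight_mul_norm_sq_le_of_growth hv hA).trans_lt ENNReal.ofReal_lt_top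

/-- **The dyadic far-field sum, real form**: `∫ (1+|y|)⁻⁴ ‖v y‖² dy ≤ 3A`. [folklore] -/
theorem integral_weight_mul_norm_sq_le_of_growth {v : (EuclideanSpace ℝ (Fin 3)) → (EuclideanSpace ℝ (Fin 3))} (hv : Continuous v) {A : ℝ}
    (hA : ∀ R : ℝ, 0 < R → ∫ z in ball (0 : (EuclideanSpace ℝ (Fin 3))) R, ‖v z‖ ^ 2 ≤ A * R) :
    ∫ y, ((1 + ‖y‖) ^ 4)⁻¹ * ‖v y‖ ^ 2 ≤ 3 * A := by
  have hA0 : 0 ≤ A := growth_const_nonneg hA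
  have hnn : 0 ≤ᵐ[volume] fun y => ((1 + ‖y‖) ^ 4)⁻¹ * ‖v y‖ ^ 2 :=
    ae_of_all _ fun y => mul_nonneg (by positivity) (sq_nonneg _)
  have h := lintegral_weight_mul_norm_sq_le_of_growth hv hA
  rw [← ofReal_integral_eq_lintegral_ofReal (integrable_weight_mul_norm_sq_of_growth hv hA) hnn] at h
  exact (ENNReal.ofReal_le_ofReal_iff (by positivity)).1 h

/-! ### The far potential modulo constants is bounded on `B̄(0,2)` by the growth budget -/

/-- The renormalised far integrand `y ↦ (D²Γ∞(x−y) − D²Γ∞(x₀−y))(v y, v y)` is continuous for continuous `v`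
(`D²Γ∞ ∈ C²`). [folklore] -/
theorem continuous_farIntegrand {v : (EuclideanSpace ℝ (Fin 3)) → (EuclideanSpace ℝ (Fin 3))} (hv : Continuous v) (x₀ x : (EuclideanSpace ℝ (Fin 3))) :
    Continuous fun y => (fderiv ℝ (fderiv ℝ (newtonFar 1 2)) (x - y) -
      fderiv ℝ (fderiv ℝ (newtonFar 1 2)) (x₀ - y)) (v y) (v y) := by
  have hK : Continuous (fderiv ℝ (fderiv ℝ (newtonFar 1 2))) :=
    (contDiff_fderiv2_newtonFar one_pos one_lt_two).continuous
  have h1 : Continuous fun y => fderiv ℝ (fderiv ℝ (newtonFar 1 2)) (x - y) -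
      fderiv ℝ (fderiv ℝ (newtonFar 1 2)) (x₀ - y) :=
    (hK.comp (continuous_const.sub continuous_id)).sub (hK.comp (continuous_const.sub continuous_id))
  exact (h1.clm_apply hv).clm_apply hv

/-- **The far part of the Riesz pressure modulo constants is bounded on `B̄(0,2)` by the growth budget**: there is an absolute
`C₀ ≥ 0` such that for every continuous `v` with `∫_{B(0,R)}‖v‖² ≤ A R` (`R > 0`) and every `|x| ≤ 2`,
`|farPotentialMod 1 2 0 v x| ≤ C₀ · A`.  (Mean-value majorant `‖D²Γ∞(x−y) − D²Γ∞(−y)‖ ≤ M·3⁴·|x|·(1+|y|)⁻⁴` of the tree and the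
dyadic sum above; no sup norm of `v` enters.) [cite: GilbargTrudinger2001, (2.14)] -/
theorem abs_farPotentialMod_le_of_growth :
    ∃ C₀ : ℝ, 0 ≤ C₀ ∧ ∀ (v : (EuclideanSpace ℝ (Fin 3)) → (EuclideanSpace ℝ (Fin 3))), Continuous v → ∀ A : ℝ,
      (∀ R : ℝ, 0 < R → ∫ z in ball (0 : (EuclideanSpace ℝ (Fin 3))) R, ‖v z‖ ^ 2 ≤ A * R) →
      ∀ x : (EuclideanSpace ℝ (Fin 3)), ‖x‖ ≤ 2 → |farPotentialMod 1 2 0 v x| ≤ C₀ * A := by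
  obtain ⟨M, hM0, hM⟩ := exists_norm_fderiv2_newtonFar_sub_sub_le one_pos one_lt_two
  refine ⟨M * 3 ^ 4 * 2 * 3, by positivity, fun v hv A hA x hx => ?_⟩
  have hA0 : 0 ≤ A := growth_const_nonneg hA
  -- pointwise domination by `M·3⁴·2 · (1+|y|)⁻⁴ ‖v y‖²`
  have hdom : ∀ y, ‖(fderiv ℝ (fderiv ℝ (newtonFar 1 2)) (x - y) -
      fderiv ℝ (fderiv ℝ (newtonFar 1 2)) (0 - y)) (v y) (v y)‖ ≤ M * 3 ^ 4 * 2 * (((1 + ‖y‖) ^ 4)⁻¹ * ‖v y‖ ^ 2) := by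
    intro y
    have hker := hM 2 x 0 y hx (by simp)
    rw [sub_zero] at hker
    calc ‖(fderiv ℝ (fderiv ℝ (newtonFar 1 2)) (x - y) - fderiv ℝ (fderiv ℝ (newtonFar 1 2)) (0 - y)) (v y) (v y)‖
        ≤ ‖(fderiv ℝ (fderiv ℝ (newtonFar 1 2)) (x - y) - fderiv ℝ (fderiv ℝ (newtonFar 1 2)) (0 - y)) (v y)‖ * ‖v y‖ :=
          ContinuousLinearMap.le_opNorm _ _
      _ ≤ ‖fderiv ℝ (fderiv ℝ (newtonFar 1 2)) (x - y) - fderiv ℝ (fderiv ℝ (newtonFar 1 2)) (0 - y)‖ * ‖v y‖ * ‖v y‖ := by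
          gcongr; exact ContinuousLinearMap.le_opNorm _ _
      _ ≤ M * (1 + 2) ^ 4 * ‖x‖ * ((1 + ‖y‖) ^ 4)⁻¹ * ‖v y‖ * ‖v y‖ := by gcongr
      _ ≤ M * (1 + 2) ^ 4 * 2 * ((1 + ‖y‖) ^ 4)⁻¹ * ‖v y‖ * ‖v y‖ := by gcongr
      _ = M * 3 ^ 4 * 2 * (((1 + ‖y‖) ^ 4)⁻¹ * ‖v y‖ ^ 2) := by norm_num; ring
  have hint : Integrable fun y => M * 3 ^ 4 * 2 * (((1 + ‖y‖) ^ 4)⁻¹ * ‖v y‖ ^ 2) :=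
    (integrable_weight_mul_norm_sq_of_growth hv hA).const_mul _
  unfold farPotentialMod
  rw [← Real.norm_eq_abs]
  calc ‖∫ y, (fderiv ℝ (fderiv ℝ (newtonFar 1 2)) (x - y) - fderiv ℝ (fderiv ℝ (newtonFar 1 2)) (0 - y)) (v y) (v y)‖
      ≤ ∫ y, M * 3 ^ 4 * 2 * (((1 + ‖y‖) ^ 4)⁻¹ * ‖v y‖ ^ 2) :=
        norm_integral_le_of_norm_le hint (Eventually.of_forall hdom)
    _ = M * 3 ^ 4 * 2 * ∫ y, ((1 + ‖y‖) ^ 4)⁻¹ * ‖v y‖ ^ 2 := integral_const_mul _ _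
    _ ≤ M * 3 ^ 4 * 2 * (3 * A) := by gcongr; exact integral_weight_mul_norm_sq_le_of_growth hv hA
    _ = M * 3 ^ 4 * 2 * 3 * A := by ring

/-! ### Locality of the near potential -/

/-- **The near potential `Q₁[v](x) = ∫ Γ₀(z) ∂ᵢ∂ⱼ(vᵢvⱼ)(x − z) dz` only sees `v` on the ball `B(x, 2)`**: if `v = v'` on `B(x,2)` then
`Q₁[v](x) = Q₁[v'](x)` (`Γ₀` vanishes for `|z| ≥ 2`, and the source is a local differential expression). [folklore] -/
theorem nearPotential_congr_of_eqOn_ball {v v' : (EuclideanSpace ℝ (Fin 3)) → (EuclideanSpace ℝ (Fin 3))} {x : (EuclideanSpace ℝ (Fin 3))} (h : EqOn v v' (ball x 2)) :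
    nearPotential 1 2 v x = nearPotential 1 2 v' x := by
  unfold nearPotential
  refine integral_congr_ae (Eventually.of_forall fun z => ?_)
  by_cases hz : ‖z‖ < 2
  · have hmem : x - z ∈ ball x 2 := by
      rw [mem_ball, dist_eq_norm, sub_sub_cancel_left, norm_neg]; exact hz
    have hev : v =ᶠ[𝓝 (x - z)] v' :=
      Filter.eventuallyEq_of_mem (isOpen_ball.mem_nhds hmem) h
    show newtonNear 1 2 z * pressureSource v (x - z) = newtonNear 1 2 z * pressureSource v' (x - z)
    rw [pressureSource_congr_of_eventuallyEq hev]
  · show newtonNear 1 2 z * pressureSource v (x - z) = newtonNear 1 2 z * pressureSource v' (x - z)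
    rw [newtonNear_eq_zero zero_le_one one_lt_two (not_lt.1 hz), zero_mul, zero_mul]

end NearExtremalTransiencePerFlow.DissipationLedger

end Summit.NavierStokesRegularity.NavierStokesRegularity.Theorems

end
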